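/-
Copyright: statement-level skeleton of a published paper (lit-balaban cell, Phase-2 proof seat p13, gen 7). No proof
claims beyond what the kernel checks below.
-/
import Literature.MathematicalPhysics.QuantumFieldTheory.BalabanImbrieJaffe1984to88.BIJ88Delta5711
import Literature.MathematicalPhysics.QuantumFieldTheory.BalabanImbrieJaffe1984to88.BIJ88Resolvent5711
import Literature.Probability.LatticeModels.PolymerGasGeometric

/-!
# `BalabanImbrieJaffe1984to88.BIJ88Neumann5711` — T. Bałaban, J. Imbrie, A. Jaffe, *Effective action and cluster
properties of the abelian Higgs model*, Commun. Math. Phys. **114** (1988) 257–315 [BalabanImbrieJaffe1988]: Sect. 5.7,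
p. 293 — CONVERGENCE OF THE EXPANSION *"Also, we expand any C^{(j)}(Λ̄₂^{(m)},u_{k+1}) as
Σ_{p=0}^∞ C^{(j)}(u_{k+1})[Σ_X Δ_j(X) C^{(j)}(u_{k+1})]^p"* FOR THE KERNELS OF [6]: the operator `Σ_X Δ_j(X)` of
(5.7.11) is SMALL in the `ℓ^∞`-operator norm — from the where-clause of (5.7.11) (`BIJ88Delta5711`: support and
`e^{−c·rek·|X|}` bound), the connectedness (2.44) of the cube regions of contributing walks
(`BIJ88RandomWalk242.cX_ne_zero_connected`) and the tree's LATTICE-ANIMAL bound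
(`Literature.Probability.LatticeModels.sum_pow_card_le_of_connected`) — so that p36's abstract Neumann identity
`BIJ88Resolvent5711.neumann5711_of_inv_add` applies in the complete normed ring of coarse kernels

statement-level skeleton of published theorems with citation tags; proofs where landed; nothing here is a claim about the Yang–Mills mass gap

PDF held: `paper:balaban1988-cmp114-bij-abelian-higgs-effective-action` (journal page = PDF page + 256); p. 293 [PDF 37]
read as an IMAGE (CCITT render `pages/original-p037-x2.png`; copy `HOME/lit-balaban-p13/pages/`).

CITATION HEADER (lean-in-tree rule).  Part of the lit-balaban TYPED SKELETON (HOME `run/shared/lean/pub/lit-balaban/`):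
WHAT IS REPRODUCED = row **C2.Eq5.7.10-5.7.12** of `HOME/lit-balaban-r16/ROWS-C2-part2.md`, the p. 293 sentence quoted
above (p36's `BIJ88Resolvent5711.neumann5711` proves it as ring algebra GIVEN `‖Σ_XΔ_j(X)·C‖ < 1`; this file supplies the
smallness for [6]'s kernels); unit `lit-balaban-p13` (gen 7), owner r16, referee ref-5.  Built BY NAME on
`BIJ88Delta5711` (`delta_support`, `abs_delta_le`, `sandwich_apply_eq_zero`, `inv5711_apply_of_deep`), `BIJ88RandomWalk578`
(`walkTerm_entry_hyps`), `BIJ88RandomWalk242` (`cX_ne_zero_connected`), `Literature.Probability.LatticeModels`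
(`IsRConnected`, `sum_pow_card_le_of_connected`), p36's `BIJ88Resolvent5711.neumann5711_of_inv_add`, Mathlib's
`Matrix.linfty_opNorm_def` / `Matrix.linfty_opNorm_mul`; nothing restated.

## The print (p. 293 [PDF 37], verbatim)

*"We insert this expansion into C^{(j)−1} to obtain C^{(j)}_{B_{m−j}(Λ₃^{(m)})}(u_{k+1})^{−1} =
C^{(j)}_{B_{m−j}(Λ₃^{(m)})}(Λ̄₂^{(m)},u_{k+1})^{−1} + Σ_X Δ_j(X), where … (5.7.11)  |Δ_j(X, x₁, x₂)| ≦ e^{−cr(e_j)|X|}, = 0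
if x₁ or x₂ ∉ X. Thus we have C^{(j)}(u_{k+1}) = C^{(j)}(Λ̄₂^{(m)},u_{k+1}) − C^{(j)}(Λ̄₂^{(m)},u_{k+1})(Σ_X Δ_j(X))
C^{(j)}(u_{k+1}). … Also, we expand any C^{(j)}_{B_{m−j}(Λ₃^{(m)})}(Λ̄₂^{(m)},u_{k+1}) as
Σ_{p=0}^∞ C^{(j)}_{B_{m−j}(Λ₃^{(m)})}(u_{k+1}) [Σ_X Δ_j(X) C^{(j)}_{B_{m−j}(Λ₃^{(m)})}(u_{k+1})]^p"*.

## The typing (model instance, READING declared)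

As in `BIJ88Delta5711`: fine sites `σ`, labels `ι`, cubes `κ`, COARSE sites `τ` (here: the unit-lattice sites of
`B_{m−j}(Λ₃^{(m)})`, all deep inside `Λ̄₂^{(m)}`), averaging kernels `Q : Matrix τ σ ℝ`, `Q^* : Matrix σ τ ℝ`, the pieces
`Δ_j(X) = a_j²·Q G_j(Λ̄₂,X) Q^*`.  The norm on `Matrix τ τ ℝ` is Mathlib's `ℓ^∞`-OPERATOR norm (max row sum,
`Matrix.linftyOpNormedRing`, scoped `Matrix.Norms.Operator`), a complete normed ring.
* **`row_sum_polymer_le`**, **`opNorm_sum_polymer_le`** (generic polymer-kernel smallness): a family `Δ(X)` of coarse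
  kernels indexed by cube sets, supported on `X × X` (coarse membership `cmem`), living on `R`-connected `X` only, with
  `|Δ(X)(y₁,y₂)| ≤ ε·λ^{|X|}`, at most `n₀|X|` coarse sites in `X` and at most `K₁` cubes near a coarse site, has
  `Σ_{y₂} |Σ_X Δ(X)(y₁,y₂)| ≤ 4n₀K₁·ε·λ` and `‖Σ_X Δ(X)‖ ≤ 4n₀K₁·ε·λ` as soon as `(Δ₀+1)²·2λ ≤ 1/2` (`Δ₀` the degree
  of the cube adjacency) — `|X|λ^{|X|} ≤ (2λ)^{|X|}` and the animal sum `Σ_{X ∋ c connected}(2λ)^{|X|} ≤ 4λ`.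
* **`opNorm_sum_delta_le`** — the instance for [6]'s `Δ_j(X)`: `‖Σ_X Δ_j(X)‖ ≤ 4n₀K₁·a_j²qq^*·e^{−(δ/(32K²M))·rek}`
  (support `delta_support`, bound `abs_delta_le`, connectedness from the nearest-neighbour structure of the letters
  `walkTerm_entry_hyps` + *"adjacent labels have equal or adjacent cubes"* `hstep` + `cX_ne_zero_connected`).
* **`expansion5711_converges`** — the quoted sentence: with `a := a_j·1 − a_j²·Q G_{j,loc}(u) Q^* + P'` (whole-lattice
  letters), `ā :=` (5.7.11) (region letters), `D := Σ_X Δ_j(X)`, the agreement of the two letter families near every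
  coarse site (`BIJ88Delta5711.middle_apply_eq_zero`: *"We only need to look at this operator in Λ̄₃"*) gives `a = ā + D`
  EXACTLY, and for any `C`, `C̄` with `aC = 1`, `C̄ā = 1` and `‖DC‖ < 1`: `C̄ = Σ_{p≥0} C(DC)^p`
  (`BIJ88Resolvent5711.neumann5711_of_inv_add`); **`expansion5711_converges_of_large`** — the same under the explicit
  largeness `4n₀K₁a_j²qq^*e^{−(δ/(32K²M))rek}·‖C‖ < 1` (`Matrix.linfty_opNorm_mul`).
HONEST SCOPE: the covariances `C`, `C̄` are hypotheses (inverses of the two quadratic forms), not constructed; the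
middle term of the p. 293 rewriting is removed by exact agreement (ρ-neighbourhood model), not by an `e^{−cr(e_j)}` bound.

Theorems only (two private folklore helpers); no definitions, no `Prop` facts; axioms standard.
-/

namespace Literature.MathematicalPhysics.QuantumFieldTheory.BalabanImbrieJaffe1984to88.BIJ88Neumann5711

open Finset
open Literature.MathematicalPhysics.QuantumFieldTheory.Balaban1983to89.B4RandomWalk213
open BIJ88RandomWalk242 BIJ88RandomWalk578 BIJ88Delta5711
open Literature.Probability.LatticeModels (IsRConnected sum_pow_card_le_of_connected)
open scoped Matrix Matrix.Norms.Operator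

variable {ι σ τ κ : Type*} [Fintype ι] [DecidableEq ι] [Fintype σ] [DecidableEq σ] [Fintype τ] [DecidableEq τ]
  [Fintype κ] [DecidableEq κ]

/-! ## §0 Two folklore helpers -/

section Helpers

omit [Fintype ι] [DecidableEq ι] [Fintype σ] [DecidableEq σ] [Fintype κ] [DecidableEq κ] in
/-- the `ℓ^∞`-operator norm of a real kernel is at most any common bound of its absolute row sums. [folklore] -/
private theorem opNorm_le_of_row_sums (A : Matrix τ τ ℝ) {C : ℝ} (h : ∀ i, ∑ j, |A i j| ≤ C) (hC : 0 ≤ C) :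
    ‖A‖ ≤ C := by
  rw [Matrix.linfty_opNorm_def]
  have key : (Finset.univ.sup fun i => ∑ j, ‖A i j‖₊ : NNReal) ≤ C.toNNReal := by
    refine Finset.sup_le fun i _ => ?_
    rw [← NNReal.coe_le_coe, Real.coe_toNNReal C hC]
    simp only [NNReal.coe_sum, coe_nnnorm, Real.norm_eq_abs]
    exact h i
  have h2 := NNReal.coe_le_coe.mpr key
  rwa [Real.coe_toNNReal C hC] at h2

omit [Fintype ι] [DecidableEq ι] [Fintype σ] [DecidableEq σ] [Fintype τ] [DecidableEq τ] [Fintype κ] [DecidableEq κ] in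
/-- connectedness of the cube graph induced on `X` (the form delivered by `BIJ88RandomWalk242.cX_ne_zero_connected`) gives
the polymer-gas notion `IsRConnected` for the symmetrised adjacency. [folklore] -/
private theorem isRConnected_of_induce_connected {Rc : κ → κ → Prop} {X : Finset κ}
    (h : ((SimpleGraph.fromRel Rc).induce (↑X : Set κ)).Connected) :
    IsRConnected (fun c c' => Rc c c' ∨ Rc c' c) X := by
  refine ⟨?_, fun v hv w hw => ?_⟩
  · obtain ⟨c, hc⟩ := h.nonempty.some
    exact ⟨c, Finset.mem_coe.mp hc⟩
  · have hr := h.preconnected ⟨v, Finset.mem_coe.mpr hv⟩ ⟨w, Finset.mem_coe.mpr hw⟩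
    rw [SimpleGraph.reachable_iff_reflTransGen] at hr
    exact hr.lift Subtype.val fun p q hpq => by
      rw [SimpleGraph.induce_adj, SimpleGraph.fromRel_adj] at hpq
      exact ⟨hpq.2, Finset.mem_coe.mp p.2, Finset.mem_coe.mp q.2⟩

end Helpers

/-! ## §1 Generic smallness of a polymer-indexed family of coarse kernels -/

section Polymer

omit [Fintype ι] [DecidableEq ι] [Fintype σ] [DecidableEq σ] [DecidableEq τ] in
/-- **ROW SUMS OF `Σ_X Δ(X)`** — for a family of coarse kernels `Δ(X)`, `X` ranging over the finite sets of cubes: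
supported on `X × X` (`hsupp`, coarse membership `cmem`), nonzero only on `R`-connected `X` (`hconn`), bounded by
`ε·λ^{|X|}` (`hbound`), with at most `n₀·|X|` coarse sites in `X` (`hcount`) and every coarse site of `X` within reach
of one of its `≤ K₁` nearby cubes (`hnear`), and a cube adjacency of degree `≤ Δ₀` with `(Δ₀ + 1)²·2λ ≤ 1/2`:
`Σ_{y₂} |Σ_X Δ(X)(y₁,y₂)| ≤ 4n₀K₁·ε·λ` — each row meets only connected `X` through a nearby cube, `|X|λ^{|X|} ≤ (2λ)^{|X|}`,
and the lattice-animal sum `Σ_{X ∋ c}(2λ)^{|X|} ≤ 4λ` (`Literature.Probability.LatticeModels.sum_pow_card_le_of_connected`).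
[cite: BalabanImbrieJaffe1988, (5.7.11) p.293] -/
theorem row_sum_polymer_le (Rc : κ → κ → Prop) (hRc : ∀ x y, Rc x y → Rc y x) (nbr : κ → Finset κ) {Δ₀ : ℕ}
    (hΔ₀ : ∀ x, (nbr x).card ≤ Δ₀) (hnbr : ∀ x y, Rc x y → y ∈ nbr x)
    (Dl : Finset κ → Matrix τ τ ℝ) (cmem : τ → Finset κ → Prop)
    (hsupp : ∀ X y₁ y₂, Dl X y₁ y₂ ≠ 0 → cmem y₁ X ∧ cmem y₂ X)
    (hconn : ∀ X y₁ y₂, Dl X y₁ y₂ ≠ 0 → IsRConnected Rc X)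
    (near : τ → Finset κ) {K₁ : ℕ} (hK₁ : ∀ y, (near y).card ≤ K₁)
    (hnear : ∀ y X, cmem y X → ∃ c ∈ near y, c ∈ X)
    {n₀ : ℕ} (hcount : ∀ (X : Finset κ) (S : Finset τ), (∀ y ∈ S, cmem y X) → S.card ≤ n₀ * X.card)
    {ε lam : ℝ} (hε : 0 ≤ ε) (hlam : 0 ≤ lam) (hbound : ∀ X y₁ y₂, |Dl X y₁ y₂| ≤ ε * lam ^ X.card)
    (hsmall : ((Δ₀ : ℝ) + 1) ^ 2 * (2 * lam) ≤ 1 / 2) (y₁ : τ) :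
    ∑ y₂, |(∑ X, Dl X) y₁ y₂| ≤ 4 * n₀ * K₁ * ε * lam := by
  classical
  -- the row sum of one piece
  have hrow : ∀ X, ∑ y₂, |Dl X y₁ y₂| ≤ n₀ * ε * (X.card * lam ^ X.card) := by
    intro X
    set S := Finset.univ.filter fun y₂ => |Dl X y₁ y₂| ≠ 0 with hS
    have hS' : ∀ y ∈ S, cmem y X := fun y hy =>
      (hsupp X y₁ y (abs_ne_zero.mp (Finset.mem_filter.mp hy).2)).2
    have h1 : ∑ y₂, |Dl X y₁ y₂| = ∑ y₂ ∈ S, |Dl X y₁ y₂| :=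
      (Finset.sum_subset (Finset.subset_univ S) fun y _ hy => by
        simp only [hS, Finset.mem_filter, Finset.mem_univ, true_and, not_not] at hy
        exact hy).symm
    rw [h1]
    calc ∑ y₂ ∈ S, |Dl X y₁ y₂| ≤ ∑ y₂ ∈ S, ε * lam ^ X.card := Finset.sum_le_sum fun y₂ _ => hbound X y₁ y₂
      _ = S.card * (ε * lam ^ X.card) := by rw [Finset.sum_const, nsmul_eq_mul]
      _ ≤ ((n₀ * X.card : ℕ) : ℝ) * (ε * lam ^ X.card) :=
          mul_le_mul_of_nonneg_right (by exact_mod_cast hcount X S hS') (mul_nonneg hε (pow_nonneg hlam _))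
      _ = n₀ * ε * (X.card * lam ^ X.card) := by push_cast; ring
  -- the pieces met by the row `y₁`
  set F := Finset.univ.filter fun X : Finset κ => ∃ y₂, Dl X y₁ y₂ ≠ 0 with hF
  have hF1 : ∀ X ∈ F, cmem y₁ X ∧ IsRConnected Rc X := by
    intro X hX
    obtain ⟨y₂, hy₂⟩ := (Finset.mem_filter.mp hX).2
    exact ⟨(hsupp X y₁ y₂ hy₂).1, hconn X y₁ y₂ hy₂⟩
  have hzero : ∀ X, X ∉ F → ∑ y₂, |Dl X y₁ y₂| = 0 := by
    intro X hX
    simp only [hF, Finset.mem_filter, Finset.mem_univ, true_and, not_exists, not_not] at hX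
    simp [hX]
  have hstep1 : ∑ y₂, |(∑ X, Dl X) y₁ y₂| ≤ ∑ X, ∑ y₂, |Dl X y₁ y₂| := by
    calc ∑ y₂, |(∑ X, Dl X) y₁ y₂| = ∑ y₂, |∑ X, Dl X y₁ y₂| := by simp_rw [Matrix.sum_apply]
      _ ≤ ∑ y₂, ∑ X, |Dl X y₁ y₂| := Finset.sum_le_sum fun y₂ _ => Finset.abs_sum_le_sum_abs _ _
      _ = ∑ X, ∑ y₂, |Dl X y₁ y₂| := Finset.sum_comm
  have hstep2 : ∑ X, ∑ y₂, |Dl X y₁ y₂| = ∑ X ∈ F, ∑ y₂, |Dl X y₁ y₂| :=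
    (Finset.sum_subset (Finset.subset_univ F) fun X _ hX => hzero X hX).symm
  have hg0 : ∀ X : Finset κ, 0 ≤ (2 * lam) ^ X.card := fun X => pow_nonneg (by positivity) _
  have hstep3 : ∀ X : Finset κ, (X.card : ℝ) * lam ^ X.card ≤ (2 * lam) ^ X.card := by
    intro X
    rw [mul_pow]
    exact mul_le_mul_of_nonneg_right (by exact_mod_cast X.card.lt_two_pow_self.le) (pow_nonneg hlam _)
  have hstep4 : ∑ X ∈ F, ∑ y₂, |Dl X y₁ y₂| ≤ n₀ * ε * ∑ X ∈ F, (2 * lam) ^ X.card := by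
    rw [Finset.mul_sum]
    refine Finset.sum_le_sum fun X _ => (hrow X).trans ?_
    exact mul_le_mul_of_nonneg_left (hstep3 X) (by positivity)
  -- cover `F` by the connected families through the cubes near `y₁`
  have hstep5 : ∑ X ∈ F, (2 * lam) ^ X.card ≤
      ∑ c ∈ near y₁, ∑ X ∈ Finset.univ.filter (fun X : Finset κ => c ∈ X ∧ IsRConnected Rc X),
        (2 * lam) ^ X.card := by
    calc ∑ X ∈ F, (2 * lam) ^ X.card
        ≤ ∑ X ∈ F, ∑ c ∈ near y₁, (if c ∈ X then (2 * lam) ^ X.card else 0) := by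
          refine Finset.sum_le_sum fun X hX => ?_
          obtain ⟨c, hc, hcX⟩ := hnear y₁ X (hF1 X hX).1
          calc (2 * lam) ^ X.card = (if c ∈ X then (2 * lam) ^ X.card else 0) := by rw [if_pos hcX]
            _ ≤ ∑ c ∈ near y₁, (if c ∈ X then (2 * lam) ^ X.card else 0) :=
                Finset.single_le_sum (f := fun c => if c ∈ X then (2 * lam) ^ X.card else 0)
                  (fun c _ => by positivity) hc
      _ = ∑ c ∈ near y₁, ∑ X ∈ F, (if c ∈ X then (2 * lam) ^ X.card else 0) := Finset.sum_comm
      _ ≤ ∑ c ∈ near y₁, ∑ X ∈ Finset.univ.filter (fun X : Finset κ => c ∈ X ∧ IsRConnected Rc X),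
            (2 * lam) ^ X.card := by
          refine Finset.sum_le_sum fun c _ => ?_
          rw [← Finset.sum_filter]
          refine Finset.sum_le_sum_of_subset_of_nonneg (fun X hX => ?_) fun X _ _ => hg0 X
          obtain ⟨hXF, hcX⟩ := Finset.mem_filter.mp hX
          exact Finset.mem_filter.mpr ⟨Finset.mem_univ _, hcX, (hF1 X hXF).2⟩
  have hstep6 : ∀ c, ∑ X ∈ Finset.univ.filter (fun X : Finset κ => c ∈ X ∧ IsRConnected Rc X),
      (2 * lam) ^ X.card ≤ 2 * (2 * lam) := fun c =>
    sum_pow_card_le_of_connected hRc hΔ₀ hnbr (by positivity) hsmall c _ fun X hX => (Finset.mem_filter.mp hX).2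
  -- assemble
  calc ∑ y₂, |(∑ X, Dl X) y₁ y₂| ≤ ∑ X ∈ F, ∑ y₂, |Dl X y₁ y₂| := hstep1.trans_eq hstep2
    _ ≤ n₀ * ε * ∑ X ∈ F, (2 * lam) ^ X.card := hstep4
    _ ≤ n₀ * ε * ∑ c ∈ near y₁, 2 * (2 * lam) :=
        mul_le_mul_of_nonneg_left (hstep5.trans (Finset.sum_le_sum fun c _ => hstep6 c)) (by positivity)
    _ = n₀ * ε * ((near y₁).card * (4 * lam)) := by rw [Finset.sum_const, nsmul_eq_mul]; ring
    _ ≤ n₀ * ε * (K₁ * (4 * lam)) := by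
        refine mul_le_mul_of_nonneg_left ?_ (by positivity)
        exact mul_le_mul_of_nonneg_right (by exact_mod_cast hK₁ y₁) (by positivity)
    _ = 4 * n₀ * K₁ * ε * lam := by ring

omit [Fintype ι] [DecidableEq ι] [Fintype σ] [DecidableEq σ] in
/-- **`‖Σ_X Δ(X)‖ ≤ 4n₀K₁·ε·λ`** in the `ℓ^∞`-operator norm, under the hypotheses of `row_sum_polymer_le`.
[cite: BalabanImbrieJaffe1988, (5.7.11) p.293] -/
theorem opNorm_sum_polymer_le (Rc : κ → κ → Prop) (hRc : ∀ x y, Rc x y → Rc y x) (nbr : κ → Finset κ) {Δ₀ : ℕ}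
    (hΔ₀ : ∀ x, (nbr x).card ≤ Δ₀) (hnbr : ∀ x y, Rc x y → y ∈ nbr x)
    (Dl : Finset κ → Matrix τ τ ℝ) (cmem : τ → Finset κ → Prop)
    (hsupp : ∀ X y₁ y₂, Dl X y₁ y₂ ≠ 0 → cmem y₁ X ∧ cmem y₂ X)
    (hconn : ∀ X y₁ y₂, Dl X y₁ y₂ ≠ 0 → IsRConnected Rc X)
    (near : τ → Finset κ) {K₁ : ℕ} (hK₁ : ∀ y, (near y).card ≤ K₁)
    (hnear : ∀ y X, cmem y X → ∃ c ∈ near y, c ∈ X)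
    {n₀ : ℕ} (hcount : ∀ (X : Finset κ) (S : Finset τ), (∀ y ∈ S, cmem y X) → S.card ≤ n₀ * X.card)
    {ε lam : ℝ} (hε : 0 ≤ ε) (hlam : 0 ≤ lam) (hbound : ∀ X y₁ y₂, |Dl X y₁ y₂| ≤ ε * lam ^ X.card)
    (hsmall : ((Δ₀ : ℝ) + 1) ^ 2 * (2 * lam) ≤ 1 / 2) :
    ‖∑ X, Dl X‖ ≤ 4 * n₀ * K₁ * ε * lam :=
  opNorm_le_of_row_sums _
    (fun y₁ => row_sum_polymer_le Rc hRc nbr hΔ₀ hnbr Dl cmem hsupp hconn near hK₁ hnear hcount hε hlam hbound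
      hsmall y₁)
    (by positivity)

end Polymer

/-! ## §2 The instance: `‖Σ_X Δ_j(X)‖` for [6]'s kernels -/

section Delta

/-- **`Σ_X Δ_j(X)` IS SMALL FOR `rek` LARGE** — for [6]'s kernels (hypotheses of `BIJ88Delta5711.abs_delta_le`:
letters, block supports, label metric, cube geometry; plus *"adjacent labels have equal or adjacent cubes"* `hstep`,
the degree `Δ₀` of the symmetrised cube adjacency, and the coarse-membership geometry `hQ`/`hQs`/`hnear`/`hcount`):
`‖Σ_X a_j²·Q G_j(Λ̄₂,X) Q^*‖ ≤ 4n₀K₁·(a_j²qq^*)·exp(−(δ/(32K²M))·rek)` in the `ℓ^∞`-operator norm, as soon as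
`(Δ₀+1)²·2exp(−(δ/(32K²M))·rek) ≤ 1/2`. [cite: BalabanImbrieJaffe1988, (5.7.11) p.293] -/
theorem opNorm_sum_delta_le (adj : ι → ι → Prop) [DecidableRel adj] (blk : σ → ι → Prop) {a b : ι → Matrix σ σ ℝ}
    {α β : ℝ} (hab : ∀ i l, ¬ adj i l → a i * b l = 0) (hbb : ∀ i l, ¬ adj i l → b i * b l = 0)
    (hα0 : 0 ≤ α) (hα : ∀ i, ‖a i‖ ≤ α) (hβ0 : 0 ≤ β) (hβ : ∀ i, ‖b i‖ ≤ β)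
    (haR : ∀ j x, ¬ blk x j → ∀ z, a j x z = 0) (haC : ∀ j x, ¬ blk x j → ∀ z, a j z x = 0)
    (hbC : ∀ j x, ¬ blk x j → ∀ z, b j z x = 0)
    (ldist : ι → σ → ℝ) (ρ : ℝ) (cubeOf : ι → κ) (cadj : κ → κ → Prop) [DecidableRel cadj]
    (d : ι → ι → ℝ) (hd0 : ∀ i, d i i = 0) (hdsymm : ∀ i l, d i l = d l i)
    (htri : ∀ i j l, d i l ≤ d i j + d j l) (hadj : ∀ i l, adj i l → d i l ≤ 1)
    (touch : κ → κ → Prop) [DecidableRel touch] (hrefl : ∀ c, touch c c)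
    (htsymm : ∀ c c', touch c c' → touch c' c) {K : ℕ}
    (hK : ∀ (c : κ) (Y : Finset κ), (Y.filter fun c' => touch c c').card ≤ K)
    (hKc : ∀ c : κ, (Finset.univ.filter fun c' => c = c' ∨ cadj c c').card ≤ K)
    {s : ℕ} (hfar : ∀ i l, ¬ touch (cubeOf i) (cubeOf l) → (s : ℝ) ≤ d i l)
    {μ b₀ : ℝ} (hμ : 0 < μ) (hld : ∀ (i l : ι) (x : σ), ldist l x ≤ ldist i x + μ * d i l)
    (hb : ∀ (x : σ) (i : ι), blk x i → ldist i x ≤ b₀) (hρ : (s : ℝ) / 8 ≤ (ρ - b₀) / μ)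
    {δ : ℝ} {D s₀ : ℕ} (hD : ∀ j, (Finset.univ.filter fun i => adj j i).card ≤ D) (hδ : 0 < δ)
    (hθ : (D : ℝ) * β ≤ Real.exp (-δ))
    (hS₀ : ∀ x, ∃ S₀ : Finset ι, S₀.card ≤ s₀ ∧ ∀ i, blk x i → i ∈ S₀)
    {M rek : ℝ} (hM : 0 < M) (hs : rek ≤ M * s)
    (hlarge : s₀ * α / (1 - D * β) ≤ Real.exp (δ * s / (32 * K * K)))
    (hstep : ∀ j j', adj j j' → cubeOf j = cubeOf j' ∨ cadj (cubeOf j) (cubeOf j') ∨ cadj (cubeOf j') (cubeOf j))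
    {Δ₀ : ℕ} (hΔ₀ : ∀ c : κ, (Finset.univ.filter fun c' => cadj c c' ∨ cadj c' c).card ≤ Δ₀)
    (Q : Matrix τ σ ℝ) (Qs : Matrix σ τ ℝ) (aj : ℝ) {q qs : ℝ} (hq0 : 0 ≤ q) (hqs0 : 0 ≤ qs)
    (hq : ∀ y, ∑ x, |Q y x| ≤ q) (hqs : ∀ y, ∑ x, |Qs x y| ≤ qs) (cmem : τ → Finset κ → Prop)
    (hQ : ∀ y x X, Q y x ≠ 0 → memX blk cubeOf cadj x X → cmem y X)
    (hQs : ∀ y x X, Qs x y ≠ 0 → memX blk cubeOf cadj x X → cmem y X)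
    (near : τ → Finset κ) {K₁ : ℕ} (hK₁ : ∀ y, (near y).card ≤ K₁)
    (hnear : ∀ y X, cmem y X → ∃ c ∈ near y, c ∈ X)
    {n₀ : ℕ} (hcount : ∀ (X : Finset κ) (S : Finset τ), (∀ y ∈ S, cmem y X) → S.card ≤ n₀ * X.card)
    (hsmall : ((Δ₀ : ℝ) + 1) ^ 2 * (2 * Real.exp (-(δ / (32 * K * K * M)) * rek)) ≤ 1 / 2) :
    ‖∑ X, aj ^ 2 • (Q * Matrix.of (cX ldist ρ cubeOf cadj (fun ω x₁ x₂ => walkTerm a b ω x₁ x₂) X) * Qs)‖ ≤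
      4 * n₀ * K₁ * (aj ^ 2 * q * qs) * Real.exp (-(δ / (32 * K * K * M)) * rek) := by
  classical
  have hnz := (walkTerm_entry_hyps blk adj hab hbb hα hβ haR haC hbC).2
  refine opNorm_sum_polymer_le (fun c c' => cadj c c' ∨ cadj c' c) (fun x y h => h.symm)
    (fun c => Finset.univ.filter fun c' => cadj c c' ∨ cadj c' c) hΔ₀
    (fun x y h => Finset.mem_filter.mpr ⟨Finset.mem_univ _, h⟩)
    (fun X => aj ^ 2 • (Q * Matrix.of (cX ldist ρ cubeOf cadj (fun ω x₁ x₂ => walkTerm a b ω x₁ x₂) X) * Qs))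
    cmem (fun X y₁ y₂ hne => ?_) (fun X y₁ y₂ hne => ?_) near hK₁ hnear hcount (by positivity)
    (Real.exp_nonneg _) (fun X y₁ y₂ => ?_) hsmall
  · -- support
    by_contra h
    exact hne (delta_support blk haR haC hbC ldist ρ cubeOf cadj Q Qs aj cmem hQ hQs X h)
  · -- connectedness of the region
    have h1 : (Q * Matrix.of (cX ldist ρ cubeOf cadj (fun ω x₁ x₂ => walkTerm a b ω x₁ x₂) X) * Qs) y₁ y₂ ≠ 0 := by
      intro h0
      apply hne
      rw [Matrix.smul_apply, h0, smul_zero]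
    have h2 : ∃ x₁ x₂, cX ldist ρ cubeOf cadj (fun ω x₁ x₂ => walkTerm a b ω x₁ x₂) X x₁ x₂ ≠ 0 := by
      by_contra hall
      push Not at hall
      exact h1 (sandwich_apply_eq_zero fun x₁ x₂ _ _ => by rw [Matrix.of_apply]; exact hall x₁ x₂)
    obtain ⟨x₁, x₂, hx⟩ := h2
    exact isRConnected_of_induce_connected
      (cX_ne_zero_connected ldist ρ cubeOf cadj adj hstep (fun ω z₁ z₂ h => (hnz ω z₁ z₂ h).1) hx)
  · -- the bound, with `exp(−c·rek·|X|) = exp(−c·rek)^{|X|}`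
    have h := abs_delta_le adj blk hab hbb hα0 hα hβ0 hβ haR haC hbC ldist ρ cubeOf cadj d hd0 hdsymm htri hadj
      touch hrefl htsymm hK hKc hfar hμ hld hb hρ hD hδ hθ hS₀ hM hs hlarge Q Qs aj hq hqs X y₁ y₂
    have hexp : Real.exp (-(δ / (32 * K * K * M)) * rek * (X.card : ℕ)) =
        Real.exp (-(δ / (32 * K * K * M)) * rek) ^ X.card := by
      rw [← Real.exp_nat_mul]
      congr 1
      ring
    rw [hexp] at h
    exact h

end Delta

/-! ## §3 *"we expand any C^{(j)}(Λ̄₂,u_{k+1}) as Σ_{p=0}^∞ C^{(j)}(u_{k+1})[Σ_X Δ_j(X) C^{(j)}(u_{k+1})]^p"* -/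

section Neumann

omit [Fintype τ] in
/-- on the deep coarse sites the two inverse covariances differ EXACTLY by `Σ_X Δ_j(X)` as MATRICES:
`a = ā + D` (`BIJ88Delta5711.inv5711_apply_of_deep` at every entry). [cite: BalabanImbrieJaffe1988, (5.7.11) p.293] -/
theorem inv5711_eq_add_of_deep (adj : ι → ι → Prop) [DecidableRel adj]
    {a b a' b' : ι → Matrix σ σ ℝ} {G : Matrix σ σ ℝ} {α β : ℝ} {D : ℕ}
    (hab : ∀ i l, ¬ adj i l → a' i * b' l = 0) (hbb : ∀ i l, ¬ adj i l → b' i * b' l = 0)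
    (hα : ∀ i, ‖a' i‖ ≤ α) (hβ : ∀ i, ‖b' i‖ ≤ β) (hD : ∀ j, (Finset.univ.filter fun i => adj j i).card ≤ D)
    (hDβ : (D : ℝ) * β < 1) (hR : ‖∑ i, b' i‖ < 1) (hG : G * (1 - ∑ i, b' i) = ∑ i, a' i)
    (ldist : ι → σ → ℝ) (ρ : ℝ) (cubeOf : ι → κ) (cadj : κ → κ → Prop)
    (Q : Matrix τ σ ℝ) (Qs : Matrix σ τ ℝ) (aj : ℝ) (P' : Matrix τ τ ℝ)
    (hagree : ∀ (y₁ y₂ : τ) (x₁ x₂ : σ), Q y₁ x₁ ≠ 0 → Qs x₂ y₂ ≠ 0 →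
      ∀ j, ldist j x₁ ≤ ρ → ldist j x₂ ≤ ρ → a j = a' j ∧ b j = b' j) :
    aj • (1 : Matrix τ τ ℝ) - aj ^ 2 • (Q * Matrix.of (cLoc ldist ρ fun ω x₁ x₂ => walkTerm a b ω x₁ x₂) * Qs) + P' =
      (aj • (1 : Matrix τ τ ℝ) - aj ^ 2 • (Q * G * Qs) + P') +
        ∑ X, aj ^ 2 • (Q * Matrix.of (cX ldist ρ cubeOf cadj (fun ω x₁ x₂ => walkTerm a' b' ω x₁ x₂) X) * Qs) := by
  ext y₁ y₂
  conv_rhs => rw [Matrix.add_apply, Matrix.sum_apply]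
  exact inv5711_apply_of_deep adj hab hbb hα hβ hD hDβ hR hG ldist ρ cubeOf cadj Q Qs aj P' (hagree y₁ y₂)

/-- **THE p. 293 EXPANSION CONVERGES**, verbatim *"Also, we expand any C^{(j)}_{B_{m−j}(Λ₃^{(m)})}(Λ̄₂^{(m)},u_{k+1}) as
Σ_{p=0}^∞ C^{(j)}_{B_{m−j}(Λ₃^{(m)})}(u_{k+1})[Σ_X Δ_j(X) C^{(j)}_{B_{m−j}(Λ₃^{(m)})}(u_{k+1})]^p"* — for [6]'s kernels
on the deep coarse sites (agreement `hagree` of the whole-lattice letters `(a, b)` and the region letters `(a′, b′)`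
near every coarse site: *"We only need to look at this operator in Λ̄₃^{(m)}"*): with `a = a_j·1 − a_j²·Q G_{j,loc}(u) Q^*
+ P'`, `ā` the operator (5.7.11), `D = Σ_X Δ_j(X)`, any right inverse `C` of `a` and left inverse `C̄` of `ā` (the two
covariances) and `‖D C‖ < 1` in the `ℓ^∞`-operator norm: `C̄ = Σ_{p≥0} C (D C)^p` — p36's
`BIJ88Resolvent5711.neumann5711_of_inv_add` in the complete normed ring `Matrix τ τ ℝ`.
[cite: BalabanImbrieJaffe1988, (5.7.11) p.293] -/
theorem expansion5711_converges (adj : ι → ι → Prop) [DecidableRel adj]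
    {a b a' b' : ι → Matrix σ σ ℝ} {G : Matrix σ σ ℝ} {α β : ℝ} {D : ℕ}
    (hab : ∀ i l, ¬ adj i l → a' i * b' l = 0) (hbb : ∀ i l, ¬ adj i l → b' i * b' l = 0)
    (hα : ∀ i, ‖a' i‖ ≤ α) (hβ : ∀ i, ‖b' i‖ ≤ β) (hD : ∀ j, (Finset.univ.filter fun i => adj j i).card ≤ D)
    (hDβ : (D : ℝ) * β < 1) (hR : ‖∑ i, b' i‖ < 1) (hG : G * (1 - ∑ i, b' i) = ∑ i, a' i)
    (ldist : ι → σ → ℝ) (ρ : ℝ) (cubeOf : ι → κ) (cadj : κ → κ → Prop)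
    (Q : Matrix τ σ ℝ) (Qs : Matrix σ τ ℝ) (aj : ℝ) (P' : Matrix τ τ ℝ)
    (hagree : ∀ (y₁ y₂ : τ) (x₁ x₂ : σ), Q y₁ x₁ ≠ 0 → Qs x₂ y₂ ≠ 0 →
      ∀ j, ldist j x₁ ≤ ρ → ldist j x₂ ≤ ρ → a j = a' j ∧ b j = b' j)
    {C Cbar : Matrix τ τ ℝ}
    (hC : (aj • (1 : Matrix τ τ ℝ) -
        aj ^ 2 • (Q * Matrix.of (cLoc ldist ρ fun ω x₁ x₂ => walkTerm a b ω x₁ x₂) * Qs) + P') * C = 1)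
    (hCbar : Cbar * (aj • (1 : Matrix τ τ ℝ) - aj ^ 2 • (Q * G * Qs) + P') = 1)
    (hsmall : ‖(∑ X, aj ^ 2 • (Q * Matrix.of (cX ldist ρ cubeOf cadj (fun ω x₁ x₂ => walkTerm a' b' ω x₁ x₂) X) *
        Qs)) * C‖ < 1) :
    Cbar = ∑' p : ℕ, C * ((∑ X, aj ^ 2 •
      (Q * Matrix.of (cX ldist ρ cubeOf cadj (fun ω x₁ x₂ => walkTerm a' b' ω x₁ x₂) X) * Qs)) * C) ^ p := by
  haveI : CompleteSpace (Matrix τ τ ℝ) := FiniteDimensional.complete ℝ (Matrix τ τ ℝ)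
  exact BIJ88Resolvent5711.neumann5711_of_inv_add hC hCbar
    (inv5711_eq_add_of_deep adj hab hbb hα hβ hD hDβ hR hG ldist ρ cubeOf cadj Q Qs aj P' hagree) hsmall

/-- **THE p. 293 EXPANSION CONVERGES FOR `rek` LARGE** — the same with the smallness DERIVED: under the hypotheses of
`opNorm_sum_delta_le` for the region letters `(a′, b′)` and `4n₀K₁·a_j²qq^*·exp(−(δ/(32K²M))·rek)·‖C‖ < 1`,
`C̄ = Σ_{p≥0} C (Σ_XΔ_j(X)·C)^p` (`‖DC‖ ≤ ‖D‖‖C‖`, `Matrix.linfty_opNorm_mul`). [cite: BalabanImbrieJaffe1988, (5.7.11) p.293] -/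
theorem expansion5711_converges_of_large (adj : ι → ι → Prop) [DecidableRel adj]
    (blk : σ → ι → Prop) {a b a' b' : ι → Matrix σ σ ℝ} {G : Matrix σ σ ℝ} {α β : ℝ}
    (hab : ∀ i l, ¬ adj i l → a' i * b' l = 0) (hbb : ∀ i l, ¬ adj i l → b' i * b' l = 0)
    (hα0 : 0 ≤ α) (hα : ∀ i, ‖a' i‖ ≤ α) (hβ0 : 0 ≤ β) (hβ : ∀ i, ‖b' i‖ ≤ β)
    (haR : ∀ j x, ¬ blk x j → ∀ z, a' j x z = 0) (haC : ∀ j x, ¬ blk x j → ∀ z, a' j z x = 0)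
    (hbC : ∀ j x, ¬ blk x j → ∀ z, b' j z x = 0)
    (ldist : ι → σ → ℝ) (ρ : ℝ) (cubeOf : ι → κ) (cadj : κ → κ → Prop) [DecidableRel cadj]
    (d : ι → ι → ℝ) (hd0 : ∀ i, d i i = 0) (hdsymm : ∀ i l, d i l = d l i)
    (htri : ∀ i j l, d i l ≤ d i j + d j l) (hadj : ∀ i l, adj i l → d i l ≤ 1)
    (touch : κ → κ → Prop) [DecidableRel touch] (hrefl : ∀ c, touch c c)
    (htsymm : ∀ c c', touch c c' → touch c' c) {K : ℕ}
    (hK : ∀ (c : κ) (Y : Finset κ), (Y.filter fun c' => touch c c').card ≤ K)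
    (hKc : ∀ c : κ, (Finset.univ.filter fun c' => c = c' ∨ cadj c c').card ≤ K)
    {s : ℕ} (hfar : ∀ i l, ¬ touch (cubeOf i) (cubeOf l) → (s : ℝ) ≤ d i l)
    {μ b₀ : ℝ} (hμ : 0 < μ) (hld : ∀ (i l : ι) (x : σ), ldist l x ≤ ldist i x + μ * d i l)
    (hb : ∀ (x : σ) (i : ι), blk x i → ldist i x ≤ b₀) (hρ : (s : ℝ) / 8 ≤ (ρ - b₀) / μ)
    {δ : ℝ} {D s₀ : ℕ} (hD : ∀ j, (Finset.univ.filter fun i => adj j i).card ≤ D) (hδ : 0 < δ)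
    (hθ : (D : ℝ) * β ≤ Real.exp (-δ)) (hDβ : (D : ℝ) * β < 1) (hR : ‖∑ i, b' i‖ < 1)
    (hG : G * (1 - ∑ i, b' i) = ∑ i, a' i)
    (hS₀ : ∀ x, ∃ S₀ : Finset ι, S₀.card ≤ s₀ ∧ ∀ i, blk x i → i ∈ S₀)
    {M rek : ℝ} (hM : 0 < M) (hs : rek ≤ M * s)
    (hlarge : s₀ * α / (1 - D * β) ≤ Real.exp (δ * s / (32 * K * K)))
    (hstep : ∀ j j', adj j j' → cubeOf j = cubeOf j' ∨ cadj (cubeOf j) (cubeOf j') ∨ cadj (cubeOf j') (cubeOf j))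
    {Δ₀ : ℕ} (hΔ₀ : ∀ c : κ, (Finset.univ.filter fun c' => cadj c c' ∨ cadj c' c).card ≤ Δ₀)
    (Q : Matrix τ σ ℝ) (Qs : Matrix σ τ ℝ) (aj : ℝ) (P' : Matrix τ τ ℝ) {q qs : ℝ} (hq0 : 0 ≤ q) (hqs0 : 0 ≤ qs)
    (hq : ∀ y, ∑ x, |Q y x| ≤ q) (hqs : ∀ y, ∑ x, |Qs x y| ≤ qs) (cmem : τ → Finset κ → Prop)
    (hQ : ∀ y x X, Q y x ≠ 0 → memX blk cubeOf cadj x X → cmem y X)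
    (hQs : ∀ y x X, Qs x y ≠ 0 → memX blk cubeOf cadj x X → cmem y X)
    (near : τ → Finset κ) {K₁ : ℕ} (hK₁ : ∀ y, (near y).card ≤ K₁)
    (hnear : ∀ y X, cmem y X → ∃ c ∈ near y, c ∈ X)
    {n₀ : ℕ} (hcount : ∀ (X : Finset κ) (S : Finset τ), (∀ y ∈ S, cmem y X) → S.card ≤ n₀ * X.card)
    (hsmall : ((Δ₀ : ℝ) + 1) ^ 2 * (2 * Real.exp (-(δ / (32 * K * K * M)) * rek)) ≤ 1 / 2)
    (hagree : ∀ (y₁ y₂ : τ) (x₁ x₂ : σ), Q y₁ x₁ ≠ 0 → Qs x₂ y₂ ≠ 0 →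
      ∀ j, ldist j x₁ ≤ ρ → ldist j x₂ ≤ ρ → a j = a' j ∧ b j = b' j)
    {C Cbar : Matrix τ τ ℝ}
    (hC : (aj • (1 : Matrix τ τ ℝ) -
        aj ^ 2 • (Q * Matrix.of (cLoc ldist ρ fun ω x₁ x₂ => walkTerm a b ω x₁ x₂) * Qs) + P') * C = 1)
    (hCbar : Cbar * (aj • (1 : Matrix τ τ ℝ) - aj ^ 2 • (Q * G * Qs) + P') = 1)
    (hCsmall : 4 * n₀ * K₁ * (aj ^ 2 * q * qs) * Real.exp (-(δ / (32 * K * K * M)) * rek) * ‖C‖ < 1) :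
    Cbar = ∑' p : ℕ, C * ((∑ X, aj ^ 2 •
      (Q * Matrix.of (cX ldist ρ cubeOf cadj (fun ω x₁ x₂ => walkTerm a' b' ω x₁ x₂) X) * Qs)) * C) ^ p := by
  have hDn := opNorm_sum_delta_le adj blk hab hbb hα0 hα hβ0 hβ haR haC hbC ldist ρ cubeOf cadj d hd0 hdsymm htri hadj
    touch hrefl htsymm hK hKc hfar hμ hld hb hρ hD hδ hθ hS₀ hM hs hlarge hstep hΔ₀ Q Qs aj hq0 hqs0 hq hqs cmem hQ hQs
    near hK₁ hnear hcount hsmall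
  refine expansion5711_converges adj hab hbb hα hβ hD hDβ hR hG ldist ρ cubeOf cadj Q Qs aj P' hagree hC hCbar ?_
  refine (Matrix.linfty_opNorm_mul _ _).trans_lt ?_
  exact (mul_le_mul_of_nonneg_right hDn (norm_nonneg _)).trans_lt hCsmall

end Neumann

end Literature.MathematicalPhysics.QuantumFieldTheory.BalabanImbrieJaffe1984to88.BIJ88Neumann5711
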